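import Summits.ResolutionOfSingularities.ResolutionOfSingularities.Theorems.HilbertSamuelEliminationSigmaMaxModificationsCorridor3SigmaSurfaceBadnessPointCureExc
import Summits.ResolutionOfSingularities.ResolutionOfSingularities.Theorems.HilbertSamuelEliminationSigmaMaxModificationsCorridor3SigmaSurfaceBadnessCureDrop
import Literature.AlgebraicGeometry.Resolution.RegularLocalOrder
import HarnessLib

/-!
# [OURS · L1 W4.2] σ-LAYER PHASE B′ — `Corridor3SigmaSurfaceBadnessPointCureCross`: THE CURE-POINT STEP AT A COUNTED SAME-MEMBER CROSSING `x` of `Γ₀` on an snc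
# configuration of a surface — `Γ₀` is the ONLY member through `x` and `ord_x Γ₀ = 2` (two reduced branches), every point of the exceptional divisor is filtered
# out of the new crossing sets (`E` is bad: `μ_E = 1`), and off `E` the new crossing sets map injectively into the old ones minus `x`
# (res-L1-w42-stub-1 DESIGN CHECK 2 (b) «point step at such `x`: `−2` … the two new crossings lie on the bad `E`, not counted»; crux chain w42 `SigmaMaxModifications`
# stmt-ResolutionOfSingularities-18506 / conjunct `SigmaMaxModificationsCorridor3` stmt-ResolutionOfSingularities-19249; helper of res-L1-w42-stub-1 (gen 6),
# `--supports stmt-…-19249 --as helper`, counted 0)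

HONEST FRAMING. OURS bookkeeping over this seat's `…SurfaceBadnessPointCure` / `…PointCureExc` / `…CureDrop` (`not_three_codimOne_through`), the tree's divisorial
presentation (`exists_primes_stalkIdeal_divisorialPart_eq'`, `divisorialPart_eq_self_of_isLocallyPrincipal`), Literature `mul_not_mem_pow_of_not_mem_pow` (order is
additive in a regular local ring), `IsRsopPart.not_mem_sq` / `.mem_minimalPrimes_span_prod_iff`, `primeOfSpecializes_mem_minimalPrimes_of_mem_maxPoints`. NOTHING here is a
statement of H. Hironaka's manuscript [Hironaka2017] nor of [CossartJannsenSaito2020]; no named fact. AI-written; AI review is weaker than expert review.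

## Contents (namespace `…Theorems.SigmaMaxModificationsCorridor3.Sigma`)

* General: `Boundary.membersThrough_eq_singleton_of_sum_lt_two`, `exists_divisorialPoint_specializes`, `coheight_eq_two_of_two_specializes`.
* At a counted crossing `x ∈ crossingPts Γs Γ₀`: **`eq_of_mem_support_of_mem_crossingPts`** (a member through `x` is `Γ₀`), `filter_mem_support_eq_singleton_of_mem_crossingPts`,
  **`toNat_idealOrder_eq_two_of_mem_crossingPts`** (`ord_x Γ₀ = 2`).
* After the point cure `ρ`: `not_mem_crossingPts_pointCure_of_base_eq` (points of `E` are never counted), `base_mem_crossingPts_of_mem_crossingPts_pointCure` (off `E`,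
  crossings map to old crossings other than `x`), **`Boundary.ncard_crossingPts_pointCure_le`**, `Boundary.crossingPts_pointCure_comap_pointIdeal` (`= ∅`).

VACUITY SELF-CHECK. The hypotheses are those of the cure-POINT branch of (P1*) (`ℓ = 0`: `S` snc; surface: `coheight ≤ 2`; regular integral Noetherian carrier; non-zero
locally principal traces; `x` a counted crossing); DESIGN CHECK 1's witness (`Γ₀ = V(xy)`, no other member) satisfies them with `M = 2`.
-/

noncomputable section

set_option linter.dupNamespace false -- mandated namespace of this single-conjunct summit

open CategoryTheory AlgebraicGeometry TopologicalSpace IsLocalRing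
open Summit.ResolutionOfSingularities.ResolutionOfSingularities.Theorems.CampaignW42
open Literature.AlgebraicGeometry.Resolution Literature.RingTheory.HilbertSamuel

namespace Summit.ResolutionOfSingularities.ResolutionOfSingularities.Theorems.SigmaMaxModificationsCorridor3.Sigma

universe u

open Scheme.IdealSheafData

/-! ## General lemmas -/

section General

variable {D : Scheme.{u}}

/-- **A component of total multiplicity `< 2` carries exactly one member, with order one.** [folklore] -/
theorem Boundary.membersThrough_eq_singleton_of_sum_lt_two {Γs : Boundary D} {ζ : D} [IsNoetherianRing (D.presheaf.stalk ζ)] (hnz : ∀ Γ ∈ Γs, stalkIdeal Γ ζ ≠ ⊥)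
    {Γ : D.IdealSheafData} (hΓ : Γ ∈ Γs) (hζΓ : ζ ∈ (Γ.support : Set D)) (hlt : ¬ 2 ≤ (Γs.compMults ζ).sum) :
    membersThrough Γs ζ = [Γ] ∧ (idealOrder Γ ζ).toNat = 1 := by
  have hpos := Boundary.one_le_of_mem_compMults (Γs := Γs) (ζ := ζ) hnz
  have hmem : Γ ∈ membersThrough Γs ζ := mem_membersThrough_iff.mpr ⟨hΓ, hζΓ⟩
  have hlen : (Γs.compMults ζ).length ≤ (Γs.compMults ζ).sum := by
    have := List.length_le_sum_of_one_le _ hpos; simpa using this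
  rw [Boundary.length_compMults] at hlen
  have hl1 : (membersThrough Γs ζ).length ≤ 1 := by omega
  obtain ⟨Γ', hΓ'⟩ : ∃ Γ', membersThrough Γs ζ = [Γ'] := by
    match h : membersThrough Γs ζ, hmem, hl1 with
    | [a], _, _ => exact ⟨a, rfl⟩
    | [], hm, _ => simp at hm
    | a :: b :: t, _, hl => simp at hl
  rw [hΓ', List.mem_singleton] at hmem
  subst hmem
  refine ⟨hΓ', ?_⟩
  have hm : (idealOrder Γ ζ).toNat ∈ Γs.compMults ζ := Boundary.mem_compMults_iff.mpr ⟨Γ, by rw [hΓ']; exact List.mem_singleton_self _, rfl⟩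
  have h1 := hpos _ hm
  have h2 := List.single_le_sum (fun _ _ => Nat.zero_le _) _ hm
  omega

/-- **A point of the support of a non-zero locally principal ideal sheaf lies on one of its codimension-one components** (regular integral Noetherian scheme: the
divisorial presentation `Γ_x = (∏_{ζ ⤳ x} q_ζ^{a_ζ})` is a proper ideal only if some `ζ ⤳ x`). [folklore] -/
theorem exists_divisorialPoint_specializes [IsIntegral D] [IsNoetherian D] (hreg : Scheme.IsRegular D) {Γ : D.IdealSheafData} (hΓ0 : Γ ≠ ⊥)
    (hlp : IsLocallyPrincipal Γ) {x : D} (hx : x ∈ (Γ.support : Set D)) : ∃ ζ ∈ divisorialPoints Γ, ζ ⤳ x := by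
  classical
  obtain ⟨T, q, hT, -, -, hq1, -, hH⟩ := exists_primes_stalkIdeal_divisorialPart_eq' hreg hΓ0 x
  rw [divisorialPart_eq_self_of_isLocallyPrincipal hreg hΓ0 hlp] at hH
  by_contra hnone
  simp only [not_exists, not_and] at hnone
  have h1 : ∏ ζ ∈ T, q ζ ^ (idealOrder Γ ζ).toNat = 1 :=
    Finset.prod_eq_one fun ζ hζ => by rw [hq1 ζ hζ (hnone ζ (hT ζ hζ)), one_pow]
  rw [h1, Ideal.span_singleton_one] at hH
  rw [SetLike.mem_coe, mem_support_iff_stalkIdeal_le, hH, top_le_iff] at hx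
  exact (maximalIdeal.isMaximal _).ne_top hx

/-- A common specialisation of two distinct points of codimension one has codimension `≥ 2`, hence `= 2` on a surface. [folklore] -/
theorem coheight_eq_two_of_two_specializes (h2 : ∀ y : D, Order.coheight y ≤ 2) {ζ₁ ζ₂ x : D} (h₁ : Order.coheight ζ₁ = 1) (h₂' : Order.coheight ζ₂ = 1)
    (hne : ζ₁ ≠ ζ₂) (hs₁ : ζ₁ ⤳ x) (hs₂ : ζ₂ ⤳ x) : Order.coheight x = 2 := by
  refine le_antisymm (h2 x) ?_
  have hx1 : x ≠ ζ₁ := by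
    rintro rfl
    exact not_specializes_of_coheight_eq_one h₂' h₁ (Ne.symm hne) hs₂
  have hlt : x < ζ₁ := lt_of_le_not_ge (Scheme.le_iff_specializes.mpr hs₁) fun h' => hx1 ((hs₁.antisymm (Scheme.le_iff_specializes.mp h')).eq).symm
  have := Order.coheight_add_one_le hlt
  rw [h₁] at this
  exact (by norm_num : (2 : ℕ∞) = 1 + 1) ▸ this

/-- The generic point of an irreducible scheme is not a point of codimension two. [folklore] -/
theorem genericPoint_ne_of_coheight_eq_two [IrreducibleSpace D] {x : D} (hx2 : Order.coheight x = 2) : genericPoint D ≠ x := by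
  intro e
  have h0 : Order.coheight (genericPoint D) = 0 := by
    rw [Order.coheight_eq_zero]
    intro y hy
    exact Scheme.le_iff_specializes.mpr (genericPoint_specializes y)
  rw [e, hx2] at h0
  exact two_ne_zero h0

end General

/-! ## At a counted crossing -/

section Crossing

variable {D : Scheme.{u}} [IsIntegral D] [IsNoetherian D] (hreg : Scheme.IsRegular D) {Γs : Boundary D} (hne : ∀ Γ ∈ Γs, Γ ≠ ⊥)
  (hlp : ∀ Γ ∈ Γs, IsLocallyPrincipal Γ) (hS : IsStrictNormalCrossingsDivisor D Γs.divisorSet) (h2 : ∀ y : D, Order.coheight y ≤ 2)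
  {Γ₀ : D.IdealSheafData} (hΓ₀ : Γ₀ ∈ Γs) {x : D} (hx : x ∈ Γs.crossingPts Γ₀)

include hreg hne hlp hS h2 hΓ₀ hx in
/-- **AT A COUNTED CROSSING OF `Γ₀`, EVERY MEMBER THROUGH `x` IS `Γ₀`**: a member through `x` contains a codimension-one component through `x`, which is one of the two
branches of `Γ₀` at `x` (at most two codimension-one points of the snc configuration pass through `x`), and a branch on no bad component carries a single member.
[folklore] -/
theorem eq_of_mem_support_of_mem_crossingPts {Γ : D.IdealSheafData} (hΓ : Γ ∈ Γs) (hxΓ : x ∈ (Γ.support : Set D)) : Γ = Γ₀ := by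
  have hnz : ∀ Γ ∈ Γs, ∀ y : D, stalkIdeal Γ y ≠ ⊥ := fun Γ hΓ y => stalkIdeal_ne_bot_of_ne_bot (hne Γ hΓ) y
  obtain ⟨⟨ζ₁, h₁, ζ₂, h₂', hne12, hs₁, hs₂⟩, hfilt⟩ := hx
  obtain ⟨ζ, hζ, hζx⟩ := exists_divisorialPoint_specializes hreg (hne Γ hΓ) (hlp Γ hΓ) hxΓ
  have hgen : genericPoint D ∉ Γs.divisorSet := fun hg => by
    obtain ⟨Γ', hΓ', hg'⟩ := Boundary.mem_divisorSet_iff.mp hg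
    exact not_mem_support_genericPoint (hne Γ' hΓ') hg'
  have hmemS : ∀ {Γ' : D.IdealSheafData} {ζ' : D}, Γ' ∈ Γs → ζ' ∈ divisorialPoints Γ' → ζ' ∈ Γs.divisorSet :=
    fun hΓ' h => Boundary.mem_divisorSet_iff.mpr ⟨_, hΓ', h.1⟩
  have hxS : x ∈ Γs.divisorSet := Boundary.mem_divisorSet_iff.mpr ⟨Γ, hΓ, hxΓ⟩
  have h3 := not_three_codimOne_through (Boundary.isClosed_divisorSet Γs) hgen (hS.isStrictNormalCrossingsAt hxS) (h2 x) (η := ![ζ, ζ₁, ζ₂])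
    (by intro k; fin_cases k <;> simp [hmemS hΓ hζ, hmemS hΓ₀ h₁, hmemS hΓ₀ h₂'])
    (by intro k; fin_cases k <;> simp [hζ.2, h₁.2, h₂'.2]) (by intro k; fin_cases k <;> simp [hζx, hs₁, hs₂])
  have hζ12 : ζ = ζ₁ ∨ ζ = ζ₂ := by
    by_contra hno
    push Not at hno
    apply h3
    intro k k' hkk'
    fin_cases k <;> fin_cases k' <;> simp_all
  -- the branch `ζ = ζᵢ` carries only `Γ₀`
  have key : ∀ {ζ' : D}, ζ' ∈ divisorialPoints Γ₀ → ζ' ⤳ x → ζ ∈ (Γ.support : Set D) → ζ = ζ' → Γ = Γ₀ := by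
    intro ζ' hζ' hs hζΓ e
    subst e
    have hns := hfilt ζ (Boundary.mem_codimOnePoints_of_mem_divisorialPoints hΓ₀ hζ') hs
    have hm := (Boundary.membersThrough_eq_singleton_of_sum_lt_two (fun Γ' hΓ' => hnz Γ' hΓ' ζ) hΓ₀ hζ'.1 hns).1
    have : Γ ∈ membersThrough Γs ζ := mem_membersThrough_iff.mpr ⟨hΓ, hζΓ⟩
    rw [hm, List.mem_singleton] at this
    exact this
  rcases hζ12 with e | e
  · exact key h₁ hs₁ hζ.1 e
  · exact key h₂' hs₂ hζ.1 e

include hreg hne hlp hS h2 hΓ₀ hx in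
open scoped Classical in
/-- **… hence the members through `x` are the single entry `Γ₀`** (`Γ₀` occurs once: its branch `ζ₁` carries one member). [folklore] -/
theorem filter_mem_support_eq_singleton_of_mem_crossingPts : (Γs.filter fun Γ => x ∈ (Γ.support : Set D)) = [Γ₀] := by
  have hnz : ∀ Γ ∈ Γs, ∀ y : D, stalkIdeal Γ y ≠ ⊥ := fun Γ hΓ y => stalkIdeal_ne_bot_of_ne_bot (hne Γ hΓ) y
  have hxΓ₀ : x ∈ (Γ₀.support : Set D) := by
    obtain ⟨⟨ζ₁, h₁, -, -, -, hs₁, -⟩, -⟩ := hx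
    exact Γ₀.support.isClosed.closure_subset_iff.mpr (Set.singleton_subset_iff.mpr h₁.1) hs₁.mem_closure
  have hcongr : (Γs.filter fun Γ => x ∈ (Γ.support : Set D)) = Γs.filter fun Γ => Γ = Γ₀ := by
    refine List.filter_congr fun Γ hΓ => ?_
    simp only [decide_eq_decide]
    exact ⟨fun h => eq_of_mem_support_of_mem_crossingPts hreg hne hlp hS h2 hΓ₀ hx hΓ h, fun h => h ▸ hxΓ₀⟩
  rw [hcongr, List.filter_eq Γ₀]
  -- `count Γ₀ Γs = 1`
  obtain ⟨⟨ζ₁, h₁, ζ₂, h₂', hne12, hs₁, hs₂⟩, hfilt⟩ := hx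
  have hm := (Boundary.membersThrough_eq_singleton_of_sum_lt_two (fun Γ' hΓ' => hnz Γ' hΓ' ζ₁) hΓ₀ h₁.1
    (hfilt ζ₁ (Boundary.mem_codimOnePoints_of_mem_divisorialPoints hΓ₀ h₁) hs₁)).1
  have hle : (Γs.filter fun Γ => Γ = Γ₀).length ≤ (membersThrough Γs ζ₁).length := by
    unfold membersThrough
    exact (List.monotone_filter_right Γs (p := fun Γ => decide (Γ = Γ₀)) (q := fun Γ => decide (ζ₁ ∈ (Γ.support : Set D)))
      (by intro Γ h; simp only [decide_eq_true_eq] at h ⊢; exact h ▸ h₁.1)).length_le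
  rw [hm, List.length_singleton, List.filter_eq Γ₀, List.length_replicate] at hle
  have hge : 1 ≤ Γs.count Γ₀ := List.count_pos_iff.mpr hΓ₀
  have : Γs.count Γ₀ = 1 := le_antisymm hle hge
  rw [this]
  rfl

include hreg hne hlp hS h2 hΓ₀ hx in
/-- **`ord_x Γ₀ = 2` AT A COUNTED CROSSING**: the divisorial presentation of `Γ₀` at `x` has exactly the two factors of the branches through `x`, each to the power one
(no bad component through `x`), each generated by an snc parameter; their product has order exactly `2` (order is additive at a regular point). [folklore] -/
theorem toNat_idealOrder_eq_two_of_mem_crossingPts : (idealOrder Γ₀ x).toNat = 2 := by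
  classical
  have hnz : ∀ Γ ∈ Γs, ∀ y : D, stalkIdeal Γ y ≠ ⊥ := fun Γ hΓ y => stalkIdeal_ne_bot_of_ne_bot (hne Γ hΓ) y
  have hx' := hx
  obtain ⟨⟨ζ₁, h₁, ζ₂, h₂', hne12, hs₁, hs₂⟩, hfilt⟩ := hx
  haveI : IsRegularLocalRing (D.presheaf.stalk x) := hreg x
  have hgen : genericPoint D ∉ Γs.divisorSet := fun hg => by
    obtain ⟨Γ', hΓ', hg'⟩ := Boundary.mem_divisorSet_iff.mp hg
    exact not_mem_support_genericPoint (hne Γ' hΓ') hg'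
  have hmemS : ∀ {ζ' : D}, ζ' ∈ divisorialPoints Γ₀ → ζ' ∈ Γs.divisorSet := fun h => Boundary.mem_divisorSet_iff.mpr ⟨_, hΓ₀, h.1⟩
  have hxS : x ∈ Γs.divisorSet := Boundary.mem_divisorSet_iff.mpr ⟨Γ₀, hΓ₀,
    Γ₀.support.isClosed.closure_subset_iff.mpr (Set.singleton_subset_iff.mpr h₁.1) hs₁.mem_closure⟩
  -- orders one along the two branches
  have ha : ∀ {ζ' : D}, ζ' ∈ divisorialPoints Γ₀ → ζ' ⤳ x → (idealOrder Γ₀ ζ').toNat = 1 := fun hζ' hs =>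
    (Boundary.membersThrough_eq_singleton_of_sum_lt_two (fun Γ' hΓ' => hnz Γ' hΓ' _) hΓ₀ hζ'.1
      (hfilt _ (Boundary.mem_codimOnePoints_of_mem_divisorialPoints hΓ₀ hζ') hs)).2
  -- every divisorial point of `Γ₀` through `x` is `ζ₁` or `ζ₂`
  have h12 : ∀ {ζ : D}, ζ ∈ divisorialPoints Γ₀ → ζ ⤳ x → ζ = ζ₁ ∨ ζ = ζ₂ := by
    intro ζ hζ hζx
    have h3 := not_three_codimOne_through (Boundary.isClosed_divisorSet Γs) hgen (hS.isStrictNormalCrossingsAt hxS) (h2 x) (η := ![ζ, ζ₁, ζ₂])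
      (by intro k; fin_cases k <;> simp [hmemS hζ, hmemS h₁, hmemS h₂']) (by intro k; fin_cases k <;> simp [hζ.2, h₁.2, h₂'.2])
      (by intro k; fin_cases k <;> simp [hζx, hs₁, hs₂])
    by_contra hno
    push Not at hno
    apply h3
    intro k k' hkk'
    fin_cases k <;> fin_cases k' <;> simp_all
  -- the presentation
  obtain ⟨T, q, hT, hT', hqprime, hq1, hqst, hH⟩ := exists_primes_stalkIdeal_divisorialPart_eq' hreg (hne Γ₀ hΓ₀) x
  rw [divisorialPart_eq_self_of_isLocallyPrincipal hreg (hne Γ₀ hΓ₀) (hlp Γ₀ hΓ₀)] at hH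
  have hζ₁T : ζ₁ ∈ T := hT' ζ₁ h₁ hs₁
  have hζ₂T : ζ₂ ∈ T := hT' ζ₂ h₂' hs₂
  have hprod : ∏ ζ ∈ T, q ζ ^ (idealOrder Γ₀ ζ).toNat = q ζ₁ * q ζ₂ := by
    rw [Finset.prod_eq_mul ζ₁ ζ₂ hne12]
    · rw [ha h₁ hs₁, ha h₂' hs₂, pow_one, pow_one]
    · intro ζ hζ hne'
      by_cases hζx : ζ ⤳ x
      · rcases h12 (hT ζ hζ) hζx with e | e
        · exact absurd e hne'.1
        · exact absurd e hne'.2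
      · rw [hq1 ζ hζ hζx, one_pow]
    · exact fun h => absurd hζ₁T h
    · exact fun h => absurd hζ₂T h
  rw [hprod] at hH
  -- each factor is an snc parameter (order exactly one)
  obtain ⟨r, z, -, hz, hI⟩ := (isSNCIdeal_iff_exists_isRsopPart _).mp (hS.isStrictNormalCrossingsAt hxS)
  have hcl : (⟨closure Γs.divisorSet, isClosed_closure⟩ : Closeds D) = ⟨Γs.divisorSet, Boundary.isClosed_divisorSet Γs⟩ :=
    Closeds.ext (Boundary.isClosed_divisorSet Γs).closure_eq
  rw [hcl] at hI
  have hord1 : ∀ {ζ : D}, ζ ∈ T → ζ ∈ divisorialPoints Γ₀ → (hs : ζ ⤳ x) →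
      q ζ ∈ maximalIdeal (D.presheaf.stalk x) ∧ q ζ ∉ maximalIdeal (D.presheaf.stalk x) ^ 2 := by
    intro ζ hζT hζ hs
    have hmin := primeOfSpecializes_mem_minimalPrimes_of_mem_maxPoints (Z := ⟨Γs.divisorSet, Boundary.isClosed_divisorSet Γs⟩)
      (mem_maxPoints_of_coheight_eq_one hgen (hmemS hζ) hζ.2) hs
    rw [hI, hz.mem_minimalPrimes_span_prod_iff] at hmin
    obtain ⟨i, hi⟩ := hmin
    have hqi : Ideal.span {q ζ} = Ideal.span {z i} := by rw [← hqst ζ hζT, stalkIdeal_primeDivisorIdeal hs, hi]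
    have hassoc : Associated (q ζ) (z i) := Ideal.span_singleton_eq_span_singleton.mp hqi
    obtain ⟨u, hu⟩ := hassoc
    constructor
    · have : z i ∈ maximalIdeal _ := hz.mem_maximalIdeal i
      rw [← hu] at this
      exact (Ideal.mul_unit_mem_iff_mem _ u.isUnit).mp this
    · intro h
      apply hz.not_mem_sq i
      rw [← hu]
      exact Ideal.mul_mem_right _ _ h
  obtain ⟨hm₁, hn₁⟩ := hord1 hζ₁T h₁ hs₁
  obtain ⟨hm₂, hn₂⟩ := hord1 hζ₂T h₂' hs₂
  -- `ord_x (q₁ q₂) = 2`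
  have hle : (2 : ℕ∞) ≤ idealOrder Γ₀ x := by
    rw [show (2 : ℕ∞) = ((2 : ℕ) : ℕ∞) from rfl, le_idealOrder_iff, hH, Ideal.span_singleton_le_iff_mem, pow_two]
    exact Ideal.mul_mem_mul hm₁ hm₂
  have hge : idealOrder Γ₀ x ≤ 2 := by
    by_contra hlt
    have h3 : ((3 : ℕ) : ℕ∞) ≤ idealOrder Γ₀ x := by
      have := Order.add_one_le_of_lt (not_le.mp hlt)
      exact_mod_cast this
    rw [le_idealOrder_iff, hH, Ideal.span_singleton_le_iff_mem] at h3
    exact mul_not_mem_pow_of_not_mem_pow (p := 1) (q := 1) hn₁ hn₂ h3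
  have : idealOrder Γ₀ x = 2 := le_antisymm hge hle
  rw [this]
  rfl

end Crossing

end Summit.ResolutionOfSingularities.ResolutionOfSingularities.Theorems.SigmaMaxModificationsCorridor3.Sigma

end
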